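import Literature.MathematicalPhysics.QuantumFieldTheory.Balaban1983to89.B9Eq325QprimeStarLowerBoundZd

/-!
# `Balaban1983to89.B9Eq319QQStarDiagonalZd` — [Balaban1985BackgroundPropagators] (3.18)–(3.19) p. 393 ∕ (3.25) p. 394 «`Q′` IS ONTO» AT THE `ℤᵈ × 𝔸` CARRIER, AS AN
# IDENTITY: under print's full block geometry («Λ_j = Ω_j^{(j)} ∖ Ω_{j+1}^{(j)}, Ω_j ∖ Ω_{j+1} = Bʲ(Λ_j)»: every level-`j` block of a constraint point lies in `Ω₀`,
# blocks of distinct constraint points are disjoint — `FullBlockGeometry L m Λ s`) and unitary averaged transporters below level `m`, the multi-level averaging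
# `Q′ = (𝟙_{Λ_j}Q′_j(U₀))_{j≤m}` and its `τ`-adjoint satisfy **`Q′Q′* = diag((Lᵈ)^{−j})`** on `L²(𝔅, ·)`: `‖Q′*φ‖²_τ = Σ_{j≤m} (Lᵈ)^{−j} Σ_{y∈Λ_j} |φ(j,y)|²_τ`
# EXACTLY, `(Q′Q′*ψ)(j, y) = (Lᵈ)^{−j}·ψ(j, y)`, and `⟨φ, φ⟩_τ ≤ (Lᵈ)^{m}·‖Q′*φ‖²_τ` (the factor of `B9Eq325QprimeStarLowerBoundZd` square-rooted); the
# surjectivity of `Q′` itself (every background of units, under `LevelDisjoint` alone) is the companion `B9Eq319QprimeOntoZd`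

statement-level skeleton of published theorems with citation tags; proofs where landed; nothing here is a claim about the
Yang–Mills mass gap

`[Balaban1985BackgroundPropagators]` ("B9", CMP **99** (1985) 389–434) p. 393: *«we define Λ_j = Ω_j^{(j)} ∖ Ω_{j+1}^{(j)}, j = 0, 1, …, k, Ω_{k+1} = ∅, or
Ω_j ∖ Ω_{j+1} = Bʲ(Λ_j), hence Λ_j ⊂ T^{(j)}_{Lʲη} … (Q′(U)λ)(y) = Σ_{x∈B(y)} L⁻ᵈ R(U(Γ_{y,x}))λ(x), (3.18) … Q′_j(U) = Q′(Ūʲ⁻¹)⋯Q′(Ū)Q′(U), (3.19) … N(Q′) =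
{λ : Q′λ = 0}, (3.21)»*; p. 394 (3.25) («(Q′G′²Q′*)⁻¹» — meaningful because `Q′` is onto); p. 391 *«The adjoints are taken with respect to natural L² scalar products»*
(print's product on `𝔅` carries the volume weights `(Lʲη)^d`; with them `Q′Q′* = I`; the sibling files drop the weights, so the diagonal `(Lᵈ)^{−j}` appears).
`[Balaban1985Averaging]` Prop. 2 p. 26 (unitarity of the averaged transporters `Ūʲ` in the small-field window).  The proof is the single-site formula
`(Q′_jδ_xX)(y) = 𝟙[blockMap^[j]x = y]·trIter_j x X` (`B9Eq325QprimeSingleSiteZd`): each of the `(Lʲ)^d` sites `x` of the block of `(j, y)` carries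
`|(Q′*φ)(x)|_τ = (Lᵈ)^{−j}|φ(j,y)|_τ`, and sites seen by no constraint point carry `0`.  PDF held: `paper:balaban1985-cmp99-background-propagators` pp. 391–394 (re-read 2026-08-28).

CITATION HEADER (lean-in-tree rule).  Cell `pub-ymgap` (YM Track A, D-0062 ∕ D-0149), node N06 = [B9], width seat `pub-ymgap-dag-n06-w4` (g5), CLAIM-3 ∕ INTENT-3.  Inputs BY NAME:
g5 `B9Eq325QprimeStarLowerBoundZd` (`fnorm_trIter`, `single_mem_suppSub`, `re_trace_QprimeStar_single`, `fnorm_level_le_pow_mul_fnorm_QprimeStar`), g2 `B9Eq325QprimeSingleSiteZd`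
(`blockMapIter`, `blockMapIter_eq_blockMap_pow`, `trIter`, `QprimeIter_single`, `LevelDisjoint`), g2 `B9Eq325QGGQInvZd` (`levSupp`, `levForm`, `QprimeVec`, `QprimeVec_apply_of_mem`,
`QprimeStar`, `formE_qprimeStar`), dag-n06-w2's `B9Eq342CombesThomasFormZd` (`fnorm`, `fnorm_sq`, `fnorm_eq_zero_iff`, `abs_fibreForm_le`, `formE_self_eq_sum_sq`),
`QuantumLattice.BalabanRG` (`blockSites`, `mem_blockSites_iff`, `card_blockSites`, `blockMap_blockBase`), and for the cube members dag-n05-c ∕ -e's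
`B8Eq191FlatLettersCubeMember` (`under_iff_blockMap_eq`, `cubeFam_subset_zero`, `towers_disjoint_cube`), `B8Eq131Cubes.mem_cube_iff`, `B8CubeMemberZd.inBox_sq_of_mem_cubeLamS`.

WHAT IS DECLARED ∕ PROVED (kernel, 0 sorry; one `def` (a `Prop`) + theorems; no `instance`, no `notation`; faithful Hermitian tracial `τ` a PARAMETER).
* §1 ★ `re_trace_QprimeStar_apply` (THE TEST FORMULA at ANY site `x ∈ Ω₀`: `Re τ((Q′*φ)(x)* X) = Σ_{j≤m} 𝟙[blockMap^[j]x ∈ Λ_j]·Re τ(φ(j, blockMap^[j]x)* · trIter_j x X)`),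
  ★ `QprimeStar_apply_eq_zero_of_unseen` (a site whose block labels are no constraint points carries `(Q′*φ)(x) = 0`).
* §2 `FullBlockGeometry L m Λ s` (def, Prop — print's block geometry in full; `B9Eq325QprimeSingleSiteZd.LevelDisjoint` asks it of ONE site per block),
  `levelDisjoint_of_fullBlockGeometry`, `fullBlockGeometry_levelZero` (A6),
  ★★ `fullBlockGeometry_of_subset_cubeLamS` ∕ `fullBlockGeometry_cubeMember` (the cube members of [Balaban1985RegularSpaces] (1.131) satisfy it: box arithmetic over dag-n05-c∕-e's lemmas).
* §3 ★ `fnorm_QprimeStar_apply_le` ∕ ★★ `fnorm_QprimeStar_apply_eq` (`|(Q′*φ)(x)|_τ = (Lᵈ)^{−j}·|φ(j,y)|_τ` at every site of the block of `(j, y)` blind to the other points).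
* §4 ★★★ `formE_QprimeStar_self_eq` (`‖Q′*φ‖²_τ = Σ_{j≤m} (Lᵈ)^{−j} Σ_{y∈Λ_j} |φ(j,y)|²_τ` under `FullBlockGeometry`), ★★ `levForm_self_le_pow_mul_formE_QprimeStar`
  (`⟨φ, φ⟩_τ ≤ (Lᵈ)^{m}·‖Q′*φ‖²_τ`), `formE_QprimeStar_self_le_levForm` (`‖Q′*φ‖²_τ ≤ ⟨φ, φ⟩_τ`).
* §5 ★★★ `levForm_QprimeVec_QprimeStar` (`⟨χ, Q′Q′*ψ⟩_τ = Σ_j (Lᵈ)^{−j} Σ_{y∈Λ_j} Re τ(χ(j,y)* ψ(j,y))` — `Q′Q′* = diag((Lᵈ)^{−j})` in form sense, by polarization),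
  ★★★ `QprimeVec_QprimeStar_apply` (pointwise: `(Q′Q′*ψ)(p) = ((Lᵈ)^{p.1})⁻¹ • ψ(p)`).

HONEST SCOPE.  Averaging algebra at the `ℤᵈ` carrier; the only analysis is Cauchy–Schwarz in the fibre; constants exact; `L²_τ` currency (volume weights dropped, see
above); count-neutral helper (`--supports` the K1 item of record); N05 ∕ N06 NOT discharged; K1 NOT closed; one finite `𝕋⁴` programme at fixed `ε`, Bałaban as printed;
R4 closes only the conditional finite-`𝕋⁴` rung `BalabanLadder.UV` — nothing continuum ∕ ℝ⁴ ∕ OS ∕ mass gap ∕ Clay.  Unit `pub-ymgap-dag-n06-w4` (g5), 2026-08-28.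
-/

noncomputable section

namespace Literature.MathematicalPhysics.QuantumFieldTheory.Balaban1983to89.B9Eq319QQStarDiagonalZd

open B7Prop1Explicit
open B7Prop1Local (InBox)
open B7Eq78Linearization (conjR QprimeIter zdBlocking)
open B7Prop2Explicit (unitaryUnits)
open B8Ineq132 (Under)
open B8Eq119TwistedAxial (bgT bgT_one)
open B8Eq131Cubes (cube sqLo sqHi mem_cube_iff)
open B8Eq131CubesAdmissible (cubeFam cubeFam_false_of_le)
open B8CubeMemberZd (cubeLamS inBox_sq_of_mem_cubeLamS)
open B8LeafModelZd (ZdIdx)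
open B8Eq191FlatLettersCubeMember (under_iff_blockMap_eq cubeFam_subset_zero towers_disjoint_cube cubeLamS_finite cubeFam_zero_finite)
open Literature.MathematicalPhysics.QuantumLattice (blockMap blockSites mem_blockSites_iff card_blockSites blockBase blockMap_blockBase)
open B9Eq321LandauProjectionZd (suppSub formE formE_apply)
open B9Eq324DeltaPrimeAZd (single QprimeLin QprimeLin_apply)
open B9Eq325QGGQInvZd (levSupp levForm levForm_apply QprimeVec QprimeVec_apply_of_mem QprimeStar formE_qprimeStar)
open B9Eq325QprimeSingleSiteZd (blockMapIter blockMapIter_zero blockMapIter_eq_blockMap_pow trIter QprimeIter_single LevelDisjoint)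
open B9Eq342CombesThomasFormZd (fnorm fnorm_nonneg fnorm_sq fnorm_eq_zero_iff abs_fibreForm_le formE_self_eq_sum_sq)
open B9Eq325QprimeStarLowerBoundZd (fnorm_trIter single_mem_suppSub re_trace_QprimeStar_single fnorm_level_le_pow_mul_fnorm_QprimeStar)
open B9Thm311PosDefOpenZd (cubeMember_Ω0_finite)

-- `Site` alone could resolve to the torus sites of `Setup.lean`; re-export the `ℤ^d` sites of `B7Prop1Explicit`.
export B7Prop1Explicit (Site)

variable {d : ℕ} {𝔸 : Type*} [CStarAlgebra 𝔸]
variable (τ : 𝔸 →ₗ[ℂ] ℂ) (hτp : ∀ a : 𝔸, a ≠ 0 → 0 < (τ (star a * a)).re)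
  (hτt : ∀ a b : 𝔸, τ (a * b) = τ (b * a)) (hτs : ∀ a : 𝔸, τ (star a) = starRingEnd ℂ (τ a))

/-! ## §1  The test formula for `Q′*φ` at an arbitrary site -/

section Test

variable [FiniteDimensional ℝ 𝔸] {L : ℕ} [NeZero L] (U₀ : Site d → Fin d → 𝔸ˣ) {m : ℕ} {Λ : ℕ → Finset (Site d)} {s : Finset (Site d)}

include hτs in
/-- ★ **THE TEST FORMULA**: for every `x ∈ Ω₀` and `X ∈ 𝔸`,
`Re τ((Q′*φ)(x)* X) = Σ_{j ≤ m} 𝟙[blockMap^[j] x ∈ Λ_j] · Re τ(φ(j, blockMap^[j] x)* · trIter_j x X)` — adjointness `⟨Q′*φ, δ_xX⟩_{Ω₀} = ⟨φ, Q′δ_xX⟩_𝔅` and the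
single-site formula: at level `j` the field `δ_xX` is seen only by the constraint point labelling the `j`-block of `x`, if it is one.
[cite: Balaban1985BackgroundPropagators, (3.18)–(3.19) p.393, (3.25) p.394 («Q′*»), p.391 («The adjoints …»)] -/
theorem re_trace_QprimeStar_apply (φ : levSupp (𝔸 := 𝔸) m Λ) {x : Site d} (hxs : x ∈ s) (X : 𝔸) :
    (τ (star ((QprimeStar L U₀ τ m Λ s hτp φ : Site d → 𝔸) x) * X)).re =
      ∑ j ∈ Finset.range (m + 1),
        if blockMapIter L j x ∈ Λ j then (τ (star ((φ : ℕ × Site d → 𝔸) (j, blockMapIter L j x)) * trIter L U₀ j x X)).re else 0 := by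
  classical
  have h := formE_qprimeStar L U₀ τ m Λ s hτp hτs φ ⟨single x X, single_mem_suppSub hxs X⟩
  -- left side: only the site `x` contributes
  have hL : formE τ s (QprimeStar L U₀ τ m Λ s hτp φ) ⟨single x X, single_mem_suppSub hxs X⟩ =
      (τ (star ((QprimeStar L U₀ τ m Λ s hτp φ : Site d → 𝔸) x) * X)).re := by
    rw [formE_apply, Finset.sum_eq_single_of_mem x hxs]
    · show (τ (star ((QprimeStar L U₀ τ m Λ s hτp φ : Site d → 𝔸) x) * single x X x)).re = _
      simp [single]
    · intro z _ hzx
      show (τ (star ((QprimeStar L U₀ τ m Λ s hτp φ : Site d → 𝔸) z) * single x X z)).re = 0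
      simp [single, hzx]
  -- right side: level by level, only the block label of `x` can contribute
  have hR : levForm τ m Λ φ (QprimeVec L U₀ m Λ s ⟨single x X, single_mem_suppSub hxs X⟩) =
      ∑ j ∈ Finset.range (m + 1),
        if blockMapIter L j x ∈ Λ j then (τ (star ((φ : ℕ × Site d → 𝔸) (j, blockMapIter L j x)) * trIter L U₀ j x X)).re else 0 := by
    rw [levForm_apply]
    refine Finset.sum_congr rfl fun j hj => ?_
    have hterm : ∀ y ∈ Λ j, (τ (star ((φ : ℕ × Site d → 𝔸) (j, y)) *
        (QprimeVec L U₀ m Λ s ⟨single x X, single_mem_suppSub hxs X⟩ : ℕ × Site d → 𝔸) (j, y))).re =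
          if blockMapIter L j x = y then (τ (star ((φ : ℕ × Site d → 𝔸) (j, y)) * trIter L U₀ j x X)).re else 0 := by
      intro y hy
      rw [QprimeVec_apply_of_mem L U₀ m Λ s _ hj hy]
      show (τ (star ((φ : ℕ × Site d → 𝔸) (j, y)) * QprimeIter (zdBlocking d L) (bgT L U₀) j (single x X) y)).re = _
      rw [QprimeIter_single L U₀ x X j y]
      split_ifs with hxy
      · rfl
      · rw [mul_zero, map_zero, Complex.zero_re]
    rw [Finset.sum_congr rfl hterm, Finset.sum_ite_eq]
  rw [← hL, h, hR]

include hτs in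
/-- ★ **A SITE SEEN BY NO CONSTRAINT POINT CARRIES `(Q′*φ)(x) = 0`**: if `blockMap^[j] x ∉ Λ_j` for every `j ≤ m` then `(Q′*φ)(x) = 0` (test with `X = (Q′*φ)(x)`;
faithful `τ`). [cite: Balaban1985BackgroundPropagators, (3.18)–(3.19) p.393, (3.25) p.394] -/
theorem QprimeStar_apply_eq_zero_of_unseen (φ : levSupp (𝔸 := 𝔸) m Λ) {x : Site d} (hxs : x ∈ s)
    (hun : ∀ j ∈ Finset.range (m + 1), blockMapIter L j x ∉ Λ j) : (QprimeStar L U₀ τ m Λ s hτp φ : Site d → 𝔸) x = 0 := by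
  set a := (QprimeStar L U₀ τ m Λ s hτp φ : Site d → 𝔸) x with ha
  have h0 : (τ (star a * a)).re = 0 := by
    rw [ha, re_trace_QprimeStar_apply τ hτp hτs U₀ φ hxs]
    exact Finset.sum_eq_zero fun j hj => if_neg (hun j hj)
  by_contra hne
  exact (hτp a hne).ne' h0

omit [NeZero L] in
/-- off `Ω₀`, `(Q′*φ)(x) = 0` (the range of `Q′*` is `L²(Ω₀, ·)`). [cite: Balaban1985BackgroundPropagators, (3.24)–(3.25) p.394 («↾Ω₀»; bookkeeping)] -/
theorem QprimeStar_apply_eq_zero_of_not_mem (φ : levSupp (𝔸 := 𝔸) m Λ) {x : Site d} (hxs : x ∉ s) :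
    (QprimeStar L U₀ τ m Λ s hτp φ : Site d → 𝔸) x = 0 :=
  (QprimeStar L U₀ τ m Λ s hτp φ).2 x hxs

end Test

/-! ## §2  Print's full block geometry -/

section Geometry

variable (L : ℕ) (m : ℕ) (Λ : ℕ → Finset (Site d)) (s : Finset (Site d))

/-- **BLOCK GEOMETRY** — print's «Λ_j = Ω_j^{(j)} ∖ Ω_{j+1}^{(j)}, Ω_j ∖ Ω_{j+1} = Bʲ(Λ_j) ⊂ Ω₀» in operational form: for every constraint point `(j, y) ∈ 𝔅`
(a) the WHOLE level-`j` block `{x : blockMap^[j] x = y}` lies in `Ω₀ = s`, and (b) no site of that block has a level-`i` label equal to another constraint point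
`(i, y′) ∈ 𝔅` (the blocks `B^{p.1}(p.2)`, `p ∈ 𝔅`, are pairwise disjoint).  Geometry only — no background, no fibre.  (`B9Eq325QprimeSingleSiteZd.LevelDisjoint`
asks (a)–(b) of ONE site per block.) [cite: Balaban1985BackgroundPropagators, (3.18)–(3.19) p.393] -/
def FullBlockGeometry (L : ℕ) (m : ℕ) (Λ : ℕ → Finset (Site d)) (s : Finset (Site d)) : Prop :=
  ∀ j ∈ Finset.range (m + 1), ∀ y ∈ Λ j,
    (∀ x : Site d, blockMapIter L j x = y → x ∈ s) ∧
      ∀ i ∈ Finset.range (m + 1), ∀ y' ∈ Λ i, (i, y') ≠ (j, y) → ∀ x : Site d, blockMapIter L j x = y → blockMapIter L i x ≠ y'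

variable {L m Λ s}

/-- **`FullBlockGeometry ⟹ LevelDisjoint`** (`L ≠ 0`): the block corner `blockBase (Lʲ) y` is a site of the block of `(j, y)`.
[cite: Balaban1985BackgroundPropagators, (3.18)–(3.19) p.393] -/
theorem levelDisjoint_of_fullBlockGeometry [NeZero L] (h : FullBlockGeometry L m Λ s) : LevelDisjoint L m Λ s := by
  intro j hj y hy
  haveI : NeZero (L ^ j) := ⟨pow_ne_zero j (NeZero.ne L)⟩
  have hcorner : blockMapIter L j (blockBase (L ^ j) y) = y := by
    rw [blockMapIter_eq_blockMap_pow, blockMap_blockBase]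
  obtain ⟨hin, hdisj⟩ := h j hj y hy
  exact ⟨blockBase (L ^ j) y, hin _ hcorner, hcorner, fun i hi y' hy' hne => hdisj i hi y' hy' hne _ hcorner⟩

/-- **A6 ∕ NON-VACUITY**: at `m = 0` (`blockMap^[0] = id`, the block of `(0, y)` is `{y}`) the block geometry holds as soon as `Λ_0 ⊆ Ω₀`.
[cite: Balaban1985BackgroundPropagators, (3.18) p.393 (j = 0)] -/
theorem fullBlockGeometry_levelZero (hΛ : Λ 0 ⊆ s) : FullBlockGeometry L 0 Λ s := by
  intro j hj y hy
  have hj0 : j = 0 := by simpa using hj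
  subst hj0
  refine ⟨fun x hx => ?_, fun i hi y' _ hne x hx => ?_⟩
  · rw [blockMapIter_zero] at hx
    rw [hx]
    exact hΛ hy
  · have hi0 : i = 0 := by simpa using hi
    subst hi0
    rw [blockMapIter_zero] at hx ⊢
    intro h'
    exact hne (by rw [← h', hx])

/-- a site under a box point lies in the blown-up box: `Under L j y x ∧ lo ≤ y ≤ hi ⟹ tlo L lo j ≤ x ≤ thi L hi j` — i.e. `x ∈ cube` for the [Balaban1985RegularSpaces] cubes.
[cite: Balaban1985RegularSpaces, p.98 («□_j is a sum of the big blocks»)] -/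
theorem mem_cube_of_under {L : ℕ} (hL : 1 ≤ L) {a : Site d} {M ρ k j : ℕ} {y x : Site d}
    (hy : InBox (sqLo L a ρ k j) (sqHi L a M ρ k j) y) (hx : Under L j y x) : x ∈ cube L a M ρ k j :=
  (mem_cube_iff hL).2 ⟨y, hy, hx⟩

/-- ★★ **THE CUBE MEMBERS OF (1.131) SATISFY THE BLOCK GEOMETRY**: for the cube tower `{□_j}_{j=0}^{k}` (`1 ≤ L ≤ ρ`), every truncation `m ≤ k`, every finset presentation
`Λ` of sub-classes of the truncated site classes `cubeLamS … m ·` and every finite carrier `s ⊇ □₀`: (a) the whole `j`-block of `y ∈ Λ_j ⊆ □_j^{(j)} ∖ □_{j+1}^{(j)}` lies in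
`□_j ⊆ □₀` («□_j is a sum of the big blocks», `B8Eq131Cubes.mem_cube_iff` + `cubeFam_subset_zero`), (b) a fine site under two constraint points sees the same point
(`towers_disjoint_cube`). [cite: Balaban1985BackgroundPropagators, (3.18)–(3.19) p.393; Balaban1985RegularSpaces, (1.5)–(1.6) p.77, (1.68) p.88, (1.131) p.99, p.98] -/
theorem fullBlockGeometry_of_subset_cubeLamS {L : ℕ} (hL : 1 ≤ L) (a : Site d) (M : ℕ) {ρ : ℕ} (hρ : L ≤ ρ) {k m : ℕ} (hm : m ≤ k)
    {Λ : ℕ → Finset (Site d)} {s : Finset (Site d)} (hΛ : ∀ j, j ≤ m → ∀ y ∈ Λ j, y ∈ cubeLamS L a M ρ k m j)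
    (hs : cubeFam false L a M ρ k 0 ⊆ ↑s) : FullBlockGeometry L m Λ s := by
  intro j hj y hy
  have hjm : j ≤ m := Nat.lt_succ_iff.mp (Finset.mem_range.mp hj)
  have hyS : y ∈ cubeLamS L a M ρ k m j := hΛ j hjm y hy
  -- (a) the whole block lies in `□_j ⊆ □₀`
  have hblock : ∀ x : Site d, blockMapIter L j x = y → x ∈ cubeFam false L a M ρ k 0 := by
    intro x hx
    rw [blockMapIter_eq_blockMap_pow] at hx
    have hunder : Under L j y x := (under_iff_blockMap_eq hL j y x).2 hx
    have hxj : x ∈ cube L a M ρ k j := mem_cube_of_under hL (inBox_sq_of_mem_cubeLamS hyS) hunder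
    rw [← cubeFam_false_of_le L a M ρ (hjm.trans hm)] at hxj
    exact cubeFam_subset_zero hL a M hρ k j hxj
  refine ⟨fun x hx => hs (hblock x hx), fun i hi y' hy' hne x hx hxy' => ?_⟩
  -- (b) two constraint points over one fine site coincide
  have him : i ≤ m := Nat.lt_succ_iff.mp (Finset.mem_range.mp hi)
  have hx0 := hblock x hx
  rw [blockMapIter_eq_blockMap_pow] at hx hxy'
  obtain ⟨hji, hyy⟩ := towers_disjoint_cube hL a M hρ hm j hjm i him y hyS y' (hΛ i him y' hy') x hx0 hx hxy'
  exact hne (Prod.ext hji.symm hyy.symm)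

/-- ★ **AT THE CUBE MEMBER'S CANONICAL FINSETS** (`i : ZdIdx d L` with `i.Ω = cubeFam false L a Mc ρ i.k`, `Λ_j := cubeLamS … m j`, `s := □₀ = i.Ω 0`): the block geometry holds
for every truncation `m ≤ i.k` (`L ≠ 0`, `L ≤ ρ`). [cite: Balaban1985BackgroundPropagators, (3.18)–(3.19) p.393; Balaban1985RegularSpaces, (1.131) p.99] -/
theorem fullBlockGeometry_cubeMember {L : ℕ} [NeZero L] (i : ZdIdx d L) {a : Site d} {Mc ρ : ℕ} (hΩ : i.Ω = cubeFam false L a Mc ρ i.k) (hρ : L ≤ ρ)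
    {m : ℕ} (hm : m ≤ i.k) :
    FullBlockGeometry L m (fun j => (cubeLamS_finite L a Mc ρ i.k m j).toFinset) (cubeMember_Ω0_finite i hΩ).toFinset := by
  have hL1 : 1 ≤ L := Nat.one_le_iff_ne_zero.2 (NeZero.ne L)
  have hs : cubeFam false L a Mc ρ i.k 0 ⊆ ↑((cubeMember_Ω0_finite i hΩ).toFinset) := by
    rw [Set.Finite.coe_toFinset, hΩ]
  exact fullBlockGeometry_of_subset_cubeLamS hL1 a Mc hρ hm (fun j _ y hy => (Set.Finite.mem_toFinset _).1 hy) hs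

end Geometry

/-! ## §3  The modulus of `Q′*φ` on a block: `|(Q′*φ)(x)|_τ = (Lᵈ)^{−j}·|φ(j,y)|_τ` -/

section Pointwise

variable [FiniteDimensional ℝ 𝔸] {L : ℕ} [NeZero L] (U₀ : Site d → Fin d → 𝔸ˣ) {m : ℕ} {Λ : ℕ → Finset (Site d)} {s : Finset (Site d)}

include hτt hτs in
/-- ★ **`|(Q′*φ)(x)|_τ ≤ (Lᵈ)^{−j}·|φ(j,y)|_τ`** at a site `x ∈ Ω₀` of the `j`-block of the constraint point `(j, y)` blind to every other constraint point, averaged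
transporters below level `j` unitary: test with `X = (Q′*φ)(x)` — `|a|²_τ = Re τ(φ(j,y)* · trIter_j x a) ≤ |φ(j,y)|_τ·(Lᵈ)^{−j}|a|_τ`.
[cite: Balaban1985BackgroundPropagators, (3.18)–(3.19) p.393, (3.25) p.394; Balaban1985Averaging, Prop. 2 p.26] -/
theorem fnorm_QprimeStar_apply_le (φ : levSupp (𝔸 := 𝔸) m Λ) {j : ℕ} {y : Site d} (hj : j ∈ Finset.range (m + 1)) (hy : y ∈ Λ j)
    (hT : ∀ j', j' < j → ∀ z y : Site d, bgT L U₀ j' z y ∈ unitaryUnits 𝔸)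
    {x : Site d} (hxs : x ∈ s) (hxy : blockMapIter L j x = y)
    (hblind : ∀ i ∈ Finset.range (m + 1), ∀ y' ∈ Λ i, (i, y') ≠ (j, y) → blockMapIter L i x ≠ y') :
    fnorm τ ((QprimeStar L U₀ τ m Λ s hτp φ : Site d → 𝔸) x) ≤ (((L : ℝ) ^ d)⁻¹) ^ j * fnorm τ ((φ : ℕ × Site d → 𝔸) (j, y)) := by
  set a := (QprimeStar L U₀ τ m Λ s hτp φ : Site d → 𝔸) x with ha
  set b := (φ : ℕ × Site d → 𝔸) (j, y) with hb
  have hc0 : (0 : ℝ) ≤ (((L : ℝ) ^ d)⁻¹) ^ j := by positivity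
  have hsq : fnorm τ a ^ 2 ≤ fnorm τ b * ((((L : ℝ) ^ d)⁻¹) ^ j * fnorm τ a) := by
    rw [fnorm_sq hτp, ha, re_trace_QprimeStar_single τ hτp hτs U₀ φ hj hy hxs hxy hblind, ← ha, ← hb,
      ← fnorm_trIter τ hτt x a j hT]
    exact (le_abs_self _).trans (abs_fibreForm_le hτp hτs b _)
  by_cases h0 : fnorm τ a = 0
  · rw [h0]
    exact mul_nonneg hc0 (fnorm_nonneg τ b)
  · have hpos : 0 < fnorm τ a := lt_of_le_of_ne (fnorm_nonneg τ a) (Ne.symm h0)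
    have h2 : fnorm τ a * fnorm τ a ≤ ((((L : ℝ) ^ d)⁻¹) ^ j * fnorm τ b) * fnorm τ a := by
      rw [← sq]
      calc fnorm τ a ^ 2 ≤ fnorm τ b * ((((L : ℝ) ^ d)⁻¹) ^ j * fnorm τ a) := hsq
        _ = ((((L : ℝ) ^ d)⁻¹) ^ j * fnorm τ b) * fnorm τ a := by ring
    exact le_of_mul_le_mul_right h2 hpos

include hτt hτs in
/-- ★★ **`|(Q′*φ)(x)|_τ = (Lᵈ)^{−j}·|φ(j,y)|_τ`** at every site `x ∈ Ω₀` of the `j`-block of `(j, y)` blind to the other constraint points (averaged transporters below `j`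
unitary): the previous bound and `B9Eq325QprimeStarLowerBoundZd.fnorm_level_le_pow_mul_fnorm_QprimeStar`. [cite: Balaban1985BackgroundPropagators, (3.18)–(3.19) p.393, (3.25) p.394; Balaban1985Averaging, Prop. 2 p.26] -/
theorem fnorm_QprimeStar_apply_eq (φ : levSupp (𝔸 := 𝔸) m Λ) {j : ℕ} {y : Site d} (hj : j ∈ Finset.range (m + 1)) (hy : y ∈ Λ j)
    (hT : ∀ j', j' < j → ∀ z y : Site d, bgT L U₀ j' z y ∈ unitaryUnits 𝔸)
    {x : Site d} (hxs : x ∈ s) (hxy : blockMapIter L j x = y)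
    (hblind : ∀ i ∈ Finset.range (m + 1), ∀ y' ∈ Λ i, (i, y') ≠ (j, y) → blockMapIter L i x ≠ y') :
    fnorm τ ((QprimeStar L U₀ τ m Λ s hτp φ : Site d → 𝔸) x) = (((L : ℝ) ^ d)⁻¹) ^ j * fnorm τ ((φ : ℕ × Site d → 𝔸) (j, y)) := by
  refine le_antisymm (fnorm_QprimeStar_apply_le τ hτp hτt hτs U₀ φ hj hy hT hxs hxy hblind) ?_
  have h := fnorm_level_le_pow_mul_fnorm_QprimeStar τ hτp hτt hτs U₀ φ hj hy hT hxs hxy hblind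
  have hL0 : (0 : ℝ) < (L : ℝ) := by exact_mod_cast Nat.pos_of_ne_zero (NeZero.ne L)
  have hLj : (0 : ℝ) < ((L : ℝ) ^ d) ^ j := by positivity
  rw [inv_pow, inv_mul_le_iff₀ hLj]
  exact h

end Pointwise

/-! ## §4  The exact norm identity `‖Q′*φ‖²_τ = Σ_j (Lᵈ)^{−j} Σ_{y∈Λ_j} |φ(j,y)|²_τ` -/

section Exact

variable [FiniteDimensional ℝ 𝔸] {L : ℕ} [NeZero L] (U₀ : Site d → Fin d → 𝔸ˣ) (m : ℕ) (Λ : ℕ → Finset (Site d)) (s : Finset (Site d))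

/-- membership in the level-`j` block of `y` as a finset: `x ∈ blockSites (Lʲ) y ↔ blockMap^[j] x = y`.
[cite: Balaban1985BackgroundPropagators, (3.18)–(3.19) p.393 (bookkeeping); Balaban1985Averaging, (78)–(80) p.30] -/
theorem mem_blockSites_pow_iff (j : ℕ) (y x : Site d) : x ∈ blockSites (L ^ j) y ↔ blockMapIter L j x = y := by
  haveI : NeZero (L ^ j) := ⟨pow_ne_zero j (NeZero.ne L)⟩
  rw [mem_blockSites_iff, blockMapIter_eq_blockMap_pow]

include hτt hτs in
/-- ★★★ **`‖Q′*φ‖²_τ = Σ_{j≤m} (Lᵈ)^{−j} Σ_{y∈Λ_j} |φ(j,y)|²_τ` — `Q′Q′* = diag((Lᵈ)^{−j})` IN NORM**, under `FullBlockGeometry L m Λ s`, at EVERY background of units whose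
averaged transporters below level `m` are unitary: `Ω₀` splits into the pairwise disjoint blocks of the constraint points, each of whose `(Lʲ)^d` sites carries
`|(Q′*φ)(x)|²_τ = (Lᵈ)^{−2j}|φ(j,y)|²_τ` (§3), and the unseen sites, which carry `0` (§1).
[cite: Balaban1985BackgroundPropagators, (3.18)–(3.19) p.393 («Ω_j ∖ Ω_{j+1} = Bʲ(Λ_j)»), (3.21) p.394, (3.25) p.394; Balaban1985Averaging, Prop. 2 p.26] -/
theorem formE_QprimeStar_self_eq (hT : ∀ j', j' < m → ∀ z y : Site d, bgT L U₀ j' z y ∈ unitaryUnits 𝔸) (hG : FullBlockGeometry L m Λ s)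
    (φ : levSupp (𝔸 := 𝔸) m Λ) :
    formE τ s (QprimeStar L U₀ τ m Λ s hτp φ) (QprimeStar L U₀ τ m Λ s hτp φ) =
      ∑ j ∈ Finset.range (m + 1), (((L : ℝ) ^ d) ^ j)⁻¹ * ∑ y ∈ Λ j, fnorm τ ((φ : ℕ × Site d → 𝔸) (j, y)) ^ 2 := by
  classical
  set g : Site d → 𝔸 := (QprimeStar L U₀ τ m Λ s hτp φ : Site d → 𝔸) with hg
  -- the constraint set `𝔅` and the blocks
  set B : Finset (ℕ × Site d) := (Finset.range (m + 1)).biUnion fun j => (Λ j).image (Prod.mk j) with hB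
  have hmemB : ∀ p : ℕ × Site d, p ∈ B ↔ p.1 ∈ Finset.range (m + 1) ∧ p.2 ∈ Λ p.1 := by
    intro p
    simp only [hB, Finset.mem_biUnion, Finset.mem_image]
    constructor
    · rintro ⟨j, hj, y, hy, rfl⟩
      exact ⟨hj, hy⟩
    · rintro ⟨hj, hy⟩
      exact ⟨p.1, hj, p.2, hy, rfl⟩
  let blk : ℕ × Site d → Finset (Site d) := fun p => blockSites (L ^ p.1) p.2
  have hblk : ∀ (p : ℕ × Site d) (x : Site d), x ∈ blk p ↔ blockMapIter L p.1 x = p.2 := fun p x => mem_blockSites_pow_iff p.1 p.2 x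
  -- (a) blocks inside `Ω₀`; (b) blocks pairwise disjoint
  have hsub : B.biUnion blk ⊆ s := by
    intro x hx
    rw [Finset.mem_biUnion] at hx
    obtain ⟨p, hp, hxp⟩ := hx
    rw [hmemB] at hp
    exact (hG p.1 hp.1 p.2 hp.2).1 x ((hblk p x).1 hxp)
  have hdisj : (↑B : Set (ℕ × Site d)).PairwiseDisjoint blk := by
    intro p hp q hq hne
    rw [Finset.mem_coe, hmemB] at hp hq
    rw [Function.onFun, Finset.disjoint_left]
    intro x hxp hxq
    rw [hblk] at hxp hxq
    have hne' : (q.1, q.2) ≠ (p.1, p.2) := fun h' => hne (Prod.ext (Prod.ext_iff.1 h').1.symm (Prod.ext_iff.1 h').2.symm)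
    exact (hG p.1 hp.1 p.2 hp.2).2 q.1 hq.1 q.2 hq.2 hne' x hxp hxq
  -- the unseen sites of `Ω₀` carry `0`
  have hzero : ∀ x ∈ s, x ∉ B.biUnion blk → fnorm τ (g x) ^ 2 = 0 := by
    intro x hxs hxB
    have hun : ∀ j ∈ Finset.range (m + 1), blockMapIter L j x ∉ Λ j := by
      intro j hj hmem
      apply hxB
      rw [Finset.mem_biUnion]
      exact ⟨(j, blockMapIter L j x), (hmemB _).2 ⟨hj, hmem⟩, (hblk _ x).2 rfl⟩
    rw [hg, QprimeStar_apply_eq_zero_of_unseen τ hτp hτs U₀ φ hxs hun, B9Eq342CombesThomasFormZd.fnorm_zero]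
    ring
  -- on the block of `p`, each site carries `(Lᵈ)^{-2 p.1} |φ p|²`
  have hL0 : (0 : ℝ) < (L : ℝ) := by exact_mod_cast Nat.pos_of_ne_zero (NeZero.ne L)
  have hval : ∀ p ∈ B, ∀ x ∈ blk p, fnorm τ (g x) ^ 2 = ((((L : ℝ) ^ d)⁻¹) ^ p.1) ^ 2 * fnorm τ ((φ : ℕ × Site d → 𝔸) p) ^ 2 := by
    intro p hp x hxp
    rw [hmemB] at hp
    rw [hblk] at hxp
    have hjm : p.1 ≤ m := Nat.lt_succ_iff.1 (Finset.mem_range.1 hp.1)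
    have hxs : x ∈ s := (hG p.1 hp.1 p.2 hp.2).1 x hxp
    have hbl : ∀ i ∈ Finset.range (m + 1), ∀ y' ∈ Λ i, (i, y') ≠ (p.1, p.2) → blockMapIter L i x ≠ y' :=
      fun i hi y' hy' hne => (hG p.1 hp.1 p.2 hp.2).2 i hi y' hy' hne x hxp
    rw [hg, fnorm_QprimeStar_apply_eq τ hτp hτt hτs U₀ φ hp.1 hp.2 (fun j' hj' => hT j' (lt_of_lt_of_le hj' hjm)) hxs hxp hbl, mul_pow]
  -- the block sum
  have hblock : ∀ p ∈ B, ∑ x ∈ blk p, fnorm τ (g x) ^ 2 = (((L : ℝ) ^ d) ^ p.1)⁻¹ * fnorm τ ((φ : ℕ × Site d → 𝔸) p) ^ 2 := by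
    intro p hp
    rw [Finset.sum_congr rfl (hval p hp), Finset.sum_const, card_blockSites, nsmul_eq_mul]
    have hA : (((L : ℝ) ^ d) ^ p.1) ≠ 0 := by positivity
    have hcast : (((L ^ p.1) ^ d : ℕ) : ℝ) = ((L : ℝ) ^ d) ^ p.1 := by push_cast; ring
    rw [hcast, inv_pow, sq, ← mul_assoc, ← mul_assoc, mul_inv_cancel₀ hA, one_mul]
  -- assemble
  calc formE τ s (QprimeStar L U₀ τ m Λ s hτp φ) (QprimeStar L U₀ τ m Λ s hτp φ)
      = ∑ x ∈ s, fnorm τ (g x) ^ 2 := formE_self_eq_sum_sq hτp _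
    _ = ∑ x ∈ B.biUnion blk, fnorm τ (g x) ^ 2 := (Finset.sum_subset hsub hzero).symm
    _ = ∑ p ∈ B, ∑ x ∈ blk p, fnorm τ (g x) ^ 2 := Finset.sum_biUnion hdisj
    _ = ∑ p ∈ B, (((L : ℝ) ^ d) ^ p.1)⁻¹ * fnorm τ ((φ : ℕ × Site d → 𝔸) p) ^ 2 := Finset.sum_congr rfl hblock
    _ = ∑ j ∈ Finset.range (m + 1), (((L : ℝ) ^ d) ^ j)⁻¹ * ∑ y ∈ Λ j, fnorm τ ((φ : ℕ × Site d → 𝔸) (j, y)) ^ 2 := by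
        have hdisjB : (↑(Finset.range (m + 1)) : Set ℕ).PairwiseDisjoint (fun j => (Λ j).image (Prod.mk j)) := by
          intro j₁ _ j₂ _ hne
          rw [Function.onFun, Finset.disjoint_left]
          intro p hp₁ hp₂
          rw [Finset.mem_image] at hp₁ hp₂
          obtain ⟨y₁, _, rfl⟩ := hp₁
          obtain ⟨y₂, _, h2⟩ := hp₂
          exact hne (Prod.ext_iff.1 h2).1.symm
        rw [hB, Finset.sum_biUnion hdisjB]
        refine Finset.sum_congr rfl fun j _ => ?_
        rw [Finset.sum_image fun y _ y' _ h' => (Prod.ext_iff.1 h').2, Finset.mul_sum]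

include hτt hτs in
/-- ★★ **`⟨φ, φ⟩_τ ≤ (Lᵈ)^{m}·‖Q′*φ‖²_τ`** under `FullBlockGeometry` (the square root of `B9Eq325QprimeStarLowerBoundZd`'s factor: all `(Lʲ)^d` sites of a block are used, not one).
[cite: Balaban1985BackgroundPropagators, (3.18)–(3.19) p.393, (3.25) p.394, Thm 3.11 p.416; Balaban1985Averaging, Prop. 2 p.26] -/
theorem levForm_self_le_pow_mul_formE_QprimeStar (hT : ∀ j', j' < m → ∀ z y : Site d, bgT L U₀ j' z y ∈ unitaryUnits 𝔸)
    (hG : FullBlockGeometry L m Λ s) (φ : levSupp (𝔸 := 𝔸) m Λ) :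
    levForm τ m Λ φ φ ≤ ((L : ℝ) ^ d) ^ m * formE τ s (QprimeStar L U₀ τ m Λ s hτp φ) (QprimeStar L U₀ τ m Λ s hτp φ) := by
  rw [formE_QprimeStar_self_eq τ hτp hτt hτs U₀ m Λ s hT hG φ, levForm_apply, Finset.mul_sum]
  refine Finset.sum_le_sum fun j hj => ?_
  have hjm : j ≤ m := Nat.lt_succ_iff.1 (Finset.mem_range.1 hj)
  have hL1 : (1 : ℝ) ≤ (L : ℝ) ^ d := one_le_pow₀ (by exact_mod_cast Nat.one_le_iff_ne_zero.2 (NeZero.ne L))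
  have hLj : (0 : ℝ) < ((L : ℝ) ^ d) ^ j := by positivity
  rw [Finset.sum_congr rfl fun y _ => (fnorm_sq hτp ((φ : ℕ × Site d → 𝔸) (j, y))).symm, ← mul_assoc]
  have hS : 0 ≤ ∑ y ∈ Λ j, fnorm τ ((φ : ℕ × Site d → 𝔸) (j, y)) ^ 2 := Finset.sum_nonneg fun _ _ => sq_nonneg _
  have hcoef : (1 : ℝ) ≤ ((L : ℝ) ^ d) ^ m * (((L : ℝ) ^ d) ^ j)⁻¹ := by
    rw [le_mul_inv_iff₀ hLj, one_mul]
    exact pow_le_pow_right₀ hL1 hjm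
  calc ∑ y ∈ Λ j, fnorm τ ((φ : ℕ × Site d → 𝔸) (j, y)) ^ 2 = 1 * ∑ y ∈ Λ j, fnorm τ ((φ : ℕ × Site d → 𝔸) (j, y)) ^ 2 := (one_mul _).symm
    _ ≤ ((L : ℝ) ^ d) ^ m * (((L : ℝ) ^ d) ^ j)⁻¹ * ∑ y ∈ Λ j, fnorm τ ((φ : ℕ × Site d → 𝔸) (j, y)) ^ 2 := mul_le_mul_of_nonneg_right hcoef hS

include hτt hτs in
/-- **`‖Q′*φ‖²_τ ≤ ⟨φ, φ⟩_τ`** under `FullBlockGeometry` (`(Lᵈ)^{−j} ≤ 1`): `Q′*` is a contraction for the unweighted pairings.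
[cite: Balaban1985BackgroundPropagators, (3.18)–(3.19) p.393, (3.25) p.394; Balaban1985Averaging, Prop. 2 p.26] -/
theorem formE_QprimeStar_self_le_levForm (hT : ∀ j', j' < m → ∀ z y : Site d, bgT L U₀ j' z y ∈ unitaryUnits 𝔸)
    (hG : FullBlockGeometry L m Λ s) (φ : levSupp (𝔸 := 𝔸) m Λ) :
    formE τ s (QprimeStar L U₀ τ m Λ s hτp φ) (QprimeStar L U₀ τ m Λ s hτp φ) ≤ levForm τ m Λ φ φ := by
  rw [formE_QprimeStar_self_eq τ hτp hτt hτs U₀ m Λ s hT hG φ, levForm_apply]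
  refine Finset.sum_le_sum fun j _ => ?_
  have hL1 : (1 : ℝ) ≤ (L : ℝ) ^ d := one_le_pow₀ (by exact_mod_cast Nat.one_le_iff_ne_zero.2 (NeZero.ne L))
  rw [Finset.sum_congr rfl fun y _ => (fnorm_sq hτp ((φ : ℕ × Site d → 𝔸) (j, y))).symm]
  have hS : 0 ≤ ∑ y ∈ Λ j, fnorm τ ((φ : ℕ × Site d → 𝔸) (j, y)) ^ 2 := Finset.sum_nonneg fun _ _ => sq_nonneg _
  calc (((L : ℝ) ^ d) ^ j)⁻¹ * ∑ y ∈ Λ j, fnorm τ ((φ : ℕ × Site d → 𝔸) (j, y)) ^ 2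
      ≤ 1 * ∑ y ∈ Λ j, fnorm τ ((φ : ℕ × Site d → 𝔸) (j, y)) ^ 2 := mul_le_mul_of_nonneg_right (inv_le_one_of_one_le₀ (one_le_pow₀ hL1)) hS
    _ = _ := one_mul _

end Exact

/-! ## §5  `Q′Q′* = diag((Lᵈ)^{−j})` -/

section Diag

variable [FiniteDimensional ℝ 𝔸] {L : ℕ} [NeZero L] (U₀ : Site d → Fin d → 𝔸ˣ) (m : ℕ) (Λ : ℕ → Finset (Site d)) (s : Finset (Site d))

omit [FiniteDimensional ℝ 𝔸] [NeZero L] in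
include hτp in
/-- the weighted level pairing `Σ_j (Lᵈ)^{−j} Σ_{y∈Λ_j} Re τ(χ(j,y)* ψ(j,y))` on the diagonal is the weighted sum of squares.
[cite: Balaban1985BackgroundPropagators, (3.21) p.394 (bookkeeping)] -/
theorem weighted_diag_eq (χ : levSupp (𝔸 := 𝔸) m Λ) :
    ∑ j ∈ Finset.range (m + 1), (((L : ℝ) ^ d) ^ j)⁻¹ *
        ∑ y ∈ Λ j, (τ (star ((χ : ℕ × Site d → 𝔸) (j, y)) * (χ : ℕ × Site d → 𝔸) (j, y))).re =
      ∑ j ∈ Finset.range (m + 1), (((L : ℝ) ^ d) ^ j)⁻¹ * ∑ y ∈ Λ j, fnorm τ ((χ : ℕ × Site d → 𝔸) (j, y)) ^ 2 :=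
  Finset.sum_congr rfl fun j _ => by rw [Finset.sum_congr rfl fun y _ => (fnorm_sq hτp ((χ : ℕ × Site d → 𝔸) (j, y))).symm]

omit [FiniteDimensional ℝ 𝔸] [NeZero L] in
include hτs in
/-- polarization of the weighted level pairing: `W(χ+ψ, χ+ψ) = W(χ,χ) + 2W(χ,ψ) + W(ψ,ψ)` (Hermitian `τ`). [cite: Balaban1985BackgroundPropagators, p.391 («natural L² scalar products»; bookkeeping)] -/
theorem weighted_add_self (χ ψ : levSupp (𝔸 := 𝔸) m Λ) :
    ∑ j ∈ Finset.range (m + 1), (((L : ℝ) ^ d) ^ j)⁻¹ *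
        ∑ y ∈ Λ j, (τ (star (((χ + ψ : levSupp (𝔸 := 𝔸) m Λ) : ℕ × Site d → 𝔸) (j, y)) * ((χ + ψ : levSupp (𝔸 := 𝔸) m Λ) : ℕ × Site d → 𝔸) (j, y))).re =
      ∑ j ∈ Finset.range (m + 1), (((L : ℝ) ^ d) ^ j)⁻¹ * ∑ y ∈ Λ j, (τ (star ((χ : ℕ × Site d → 𝔸) (j, y)) * (χ : ℕ × Site d → 𝔸) (j, y))).re +
      2 * ∑ j ∈ Finset.range (m + 1), (((L : ℝ) ^ d) ^ j)⁻¹ * ∑ y ∈ Λ j, (τ (star ((χ : ℕ × Site d → 𝔸) (j, y)) * (ψ : ℕ × Site d → 𝔸) (j, y))).re +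
      ∑ j ∈ Finset.range (m + 1), (((L : ℝ) ^ d) ^ j)⁻¹ * ∑ y ∈ Λ j, (τ (star ((ψ : ℕ × Site d → 𝔸) (j, y)) * (ψ : ℕ × Site d → 𝔸) (j, y))).re := by
  -- pointwise polarization, then sum
  have hpt : ∀ (j : ℕ) (y : Site d),
      (τ (star (((χ + ψ : levSupp (𝔸 := 𝔸) m Λ) : ℕ × Site d → 𝔸) (j, y)) * ((χ + ψ : levSupp (𝔸 := 𝔸) m Λ) : ℕ × Site d → 𝔸) (j, y))).re =
        (τ (star ((χ : ℕ × Site d → 𝔸) (j, y)) * (χ : ℕ × Site d → 𝔸) (j, y))).re +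
          2 * (τ (star ((χ : ℕ × Site d → 𝔸) (j, y)) * (ψ : ℕ × Site d → 𝔸) (j, y))).re +
          (τ (star ((ψ : ℕ × Site d → 𝔸) (j, y)) * (ψ : ℕ × Site d → 𝔸) (j, y))).re := by
    intro j y
    have hsym : (τ (star ((ψ : ℕ × Site d → 𝔸) (j, y)) * (χ : ℕ × Site d → 𝔸) (j, y))).re =
        (τ (star ((χ : ℕ × Site d → 𝔸) (j, y)) * (ψ : ℕ × Site d → 𝔸) (j, y))).re := by
      rw [← B9Eq324DeltaPrimeAZd.fibreForm_apply, B9Eq324DeltaPrimeAZd.fibreForm_comm τ hτs, B9Eq324DeltaPrimeAZd.fibreForm_apply]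
    simp only [Submodule.coe_add, Pi.add_apply, star_add, add_mul, mul_add, map_add, Complex.add_re]
    rw [hsym]
    ring
  have hlev : ∀ j ∈ Finset.range (m + 1),
      (((L : ℝ) ^ d) ^ j)⁻¹ * ∑ y ∈ Λ j,
          (τ (star (((χ + ψ : levSupp (𝔸 := 𝔸) m Λ) : ℕ × Site d → 𝔸) (j, y)) * ((χ + ψ : levSupp (𝔸 := 𝔸) m Λ) : ℕ × Site d → 𝔸) (j, y))).re =
        (((L : ℝ) ^ d) ^ j)⁻¹ * ∑ y ∈ Λ j, (τ (star ((χ : ℕ × Site d → 𝔸) (j, y)) * (χ : ℕ × Site d → 𝔸) (j, y))).re +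
          2 * ((((L : ℝ) ^ d) ^ j)⁻¹ * ∑ y ∈ Λ j, (τ (star ((χ : ℕ × Site d → 𝔸) (j, y)) * (ψ : ℕ × Site d → 𝔸) (j, y))).re) +
          (((L : ℝ) ^ d) ^ j)⁻¹ * ∑ y ∈ Λ j, (τ (star ((ψ : ℕ × Site d → 𝔸) (j, y)) * (ψ : ℕ × Site d → 𝔸) (j, y))).re := by
    intro j _
    rw [Finset.sum_congr rfl fun y _ => hpt j y, Finset.sum_add_distrib, Finset.sum_add_distrib, ← Finset.mul_sum]
    ring
  rw [Finset.sum_congr rfl hlev, Finset.sum_add_distrib, Finset.sum_add_distrib, ← Finset.mul_sum]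

include hτt hτs in
/-- ★★★ **`Q′Q′* = diag((Lᵈ)^{−j})` IN FORM SENSE**: `⟨Q′*χ, Q′*ψ⟩_τ = Σ_{j≤m} (Lᵈ)^{−j} Σ_{y∈Λ_j} Re τ(χ(j,y)* ψ(j,y))` under `FullBlockGeometry`, averaged transporters below `m`
unitary — polarization of §4's norm identity. [cite: Balaban1985BackgroundPropagators, (3.18)–(3.19) p.393, (3.21) p.394, (3.25) p.394; Balaban1985Averaging, Prop. 2 p.26] -/
theorem formE_QprimeStar_QprimeStar_eq (hT : ∀ j', j' < m → ∀ z y : Site d, bgT L U₀ j' z y ∈ unitaryUnits 𝔸) (hG : FullBlockGeometry L m Λ s)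
    (χ ψ : levSupp (𝔸 := 𝔸) m Λ) :
    formE τ s (QprimeStar L U₀ τ m Λ s hτp χ) (QprimeStar L U₀ τ m Λ s hτp ψ) =
      ∑ j ∈ Finset.range (m + 1), (((L : ℝ) ^ d) ^ j)⁻¹ *
        ∑ y ∈ Λ j, (τ (star ((χ : ℕ × Site d → 𝔸) (j, y)) * (ψ : ℕ × Site d → 𝔸) (j, y))).re := by
  -- the three diagonal identities
  have hd : ∀ ω : levSupp (𝔸 := 𝔸) m Λ, formE τ s (QprimeStar L U₀ τ m Λ s hτp ω) (QprimeStar L U₀ τ m Λ s hτp ω) =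
      ∑ j ∈ Finset.range (m + 1), (((L : ℝ) ^ d) ^ j)⁻¹ *
        ∑ y ∈ Λ j, (τ (star ((ω : ℕ × Site d → 𝔸) (j, y)) * (ω : ℕ × Site d → 𝔸) (j, y))).re := by
    intro ω
    rw [formE_QprimeStar_self_eq τ hτp hτt hτs U₀ m Λ s hT hG ω, weighted_diag_eq τ hτp m Λ ω]
  have hsum := hd (χ + ψ)
  rw [map_add, weighted_add_self τ hτs m Λ χ ψ] at hsum
  simp only [map_add, LinearMap.add_apply] at hsum
  rw [hd χ, hd ψ, (B9Eq321LandauProjectionZd.formE_isSymm τ s hτs).eq (QprimeStar L U₀ τ m Λ s hτp ψ) (QprimeStar L U₀ τ m Λ s hτp χ)] at hsum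
  linarith

include hτt hτs in
/-- ★★★ **`Q′Q′* = diag((Lᵈ)^{−j})`, weakly on `L²(𝔅, ·)`**: `⟨χ, Q′(Q′*ψ)⟩_τ = Σ_{j≤m} (Lᵈ)^{−j} Σ_{y∈Λ_j} Re τ(χ(j,y)* ψ(j,y))` for all `χ, ψ` (adjointness + the previous identity).
[cite: Balaban1985BackgroundPropagators, (3.18)–(3.19) p.393, (3.21) p.394, (3.25) p.394; Balaban1985Averaging, Prop. 2 p.26] -/
theorem levForm_QprimeVec_QprimeStar (hT : ∀ j', j' < m → ∀ z y : Site d, bgT L U₀ j' z y ∈ unitaryUnits 𝔸) (hG : FullBlockGeometry L m Λ s)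
    (χ ψ : levSupp (𝔸 := 𝔸) m Λ) :
    levForm τ m Λ χ (QprimeVec L U₀ m Λ s (QprimeStar L U₀ τ m Λ s hτp ψ)) =
      ∑ j ∈ Finset.range (m + 1), (((L : ℝ) ^ d) ^ j)⁻¹ *
        ∑ y ∈ Λ j, (τ (star ((χ : ℕ × Site d → 𝔸) (j, y)) * (ψ : ℕ × Site d → 𝔸) (j, y))).re := by
  rw [← formE_qprimeStar L U₀ τ m Λ s hτp hτs χ, formE_QprimeStar_QprimeStar_eq τ hτp hτt hτs U₀ m Λ s hT hG χ ψ]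

omit [FiniteDimensional ℝ 𝔸] [NeZero L] in
include hτp in
/-- faithfulness in test form: `Re τ(X* a) = Re τ(X* b)` for all `X` forces `a = b`. [cite: Balaban1985BackgroundPropagators, p.390 («|X|² = tr X*X»; bookkeeping)] -/
theorem eq_of_re_trace_eq {a b : 𝔸} (h : ∀ X : 𝔸, (τ (star X * a)).re = (τ (star X * b)).re) : a = b := by
  have h0 : (τ (star (a - b) * (a - b))).re = 0 := by
    rw [mul_sub, map_sub, Complex.sub_re, h (a - b), sub_self]
  by_contra hne
  exact (hτp (a - b) (sub_ne_zero.2 hne)).ne' h0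

include hτt hτs in
/-- ★★★ **`Q′Q′* = diag((Lᵈ)^{−j})`, POINTWISE**: `(Q′(U₀)Q′(U₀)*ψ)(p) = ((Lᵈ)^{p.1})⁻¹ • ψ(p)` for every `p` (off `𝔅` both sides vanish) — under `FullBlockGeometry`, averaged
transporters below `m` unitary.  Test the weak identity against the level datum supported at `p`.
[cite: Balaban1985BackgroundPropagators, (3.18)–(3.19) p.393, (3.21) p.394, (3.25) p.394; Balaban1985Averaging, Prop. 2 p.26] -/
theorem QprimeVec_QprimeStar_apply (hT : ∀ j', j' < m → ∀ z y : Site d, bgT L U₀ j' z y ∈ unitaryUnits 𝔸) (hG : FullBlockGeometry L m Λ s)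
    (ψ : levSupp (𝔸 := 𝔸) m Λ) (p : ℕ × Site d) :
    (QprimeVec L U₀ m Λ s (QprimeStar L U₀ τ m Λ s hτp ψ) : ℕ × Site d → 𝔸) p = (((L : ℝ) ^ d) ^ p.1)⁻¹ • (ψ : ℕ × Site d → 𝔸) p := by
  classical
  by_cases hp : p.1 ∈ Finset.range (m + 1) ∧ p.2 ∈ Λ p.1
  · -- test against the datum `δ_p X`
    have hmem : ∀ X : 𝔸, (fun q : ℕ × Site d => if q = p then X else 0) ∈ levSupp (𝔸 := 𝔸) m Λ := by
      intro X q hq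
      have hqp : q ≠ p := fun h' => hq (h' ▸ hp)
      simp [hqp]
    apply eq_of_re_trace_eq τ hτp
    intro X
    have h := levForm_QprimeVec_QprimeStar τ hτp hτt hτs U₀ m Λ s hT hG ⟨_, hmem X⟩ ψ
    rw [levForm_apply] at h
    -- both sides reduce to the single point `p`
    have hlhs : ∑ j ∈ Finset.range (m + 1), ∑ y ∈ Λ j,
        (τ (star (((⟨_, hmem X⟩ : levSupp (𝔸 := 𝔸) m Λ) : ℕ × Site d → 𝔸) (j, y)) *
          (QprimeVec L U₀ m Λ s (QprimeStar L U₀ τ m Λ s hτp ψ) : ℕ × Site d → 𝔸) (j, y))).re =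
        (τ (star X * (QprimeVec L U₀ m Λ s (QprimeStar L U₀ τ m Λ s hτp ψ) : ℕ × Site d → 𝔸) p)).re := by
      rw [Finset.sum_eq_single_of_mem p.1 hp.1 (fun j _ hj => Finset.sum_eq_zero fun y _ => ?_)]
      · rw [Finset.sum_eq_single_of_mem p.2 hp.2 (fun y _ hy => ?_)]
        · simp
        · have : ((p.1, y) : ℕ × Site d) ≠ p := fun h' => hy (by rw [← h'])
          simp [this]
      · have : ((j, y) : ℕ × Site d) ≠ p := fun h' => hj (by rw [← h'])
        simp [this]
    have hrhs : ∑ j ∈ Finset.range (m + 1), (((L : ℝ) ^ d) ^ j)⁻¹ * ∑ y ∈ Λ j,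
        (τ (star (((⟨_, hmem X⟩ : levSupp (𝔸 := 𝔸) m Λ) : ℕ × Site d → 𝔸) (j, y)) * (ψ : ℕ × Site d → 𝔸) (j, y))).re =
        (τ (star X * ((((L : ℝ) ^ d) ^ p.1)⁻¹ • (ψ : ℕ × Site d → 𝔸) p))).re := by
      rw [Finset.sum_eq_single_of_mem p.1 hp.1 (fun j _ hj => ?_)]
      · rw [Finset.sum_eq_single_of_mem p.2 hp.2 (fun y _ hy => ?_)]
        · rw [mul_smul_comm, ← Complex.coe_smul, map_smul, smul_eq_mul, Complex.re_ofReal_mul]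
          simp
        · have : ((p.1, y) : ℕ × Site d) ≠ p := fun h' => hy (by rw [← h'])
          simp [this]
      · rw [Finset.sum_eq_zero fun y _ => ?_, mul_zero]
        have : ((j, y) : ℕ × Site d) ≠ p := fun h' => hj (by rw [← h'])
        simp [this]
    rw [← hlhs, h, hrhs]
  · rw [(QprimeVec L U₀ m Λ s (QprimeStar L U₀ τ m Λ s hτp ψ)).2 p hp, ψ.2 p hp, smul_zero]

end Diag

end Literature.MathematicalPhysics.QuantumFieldTheory.Balaban1983to89.B9Eq319QQStarDiagonalZd

end
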